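import Summits.PneNP.PneNP.Theorems.NegLimitedLoglogSlices
import Summits.PneNP.PneNP.Theorems.NegLimitedCliqueLikeNegLimitedLog
import Summits.PneNP.PneNP.Theorems.NegLimitedLogOverLoglogSlices
import Literature.Computability.Complexity.CliqueVerifierBricks
import Literature.Computability.Complexity.KannanLanguage

/-!
# Route NegLimited — the same rungs with an `NP`-complete witness: slices of the `⌊√m⌋`-clique language (rung F-N1/p3)

The witness of `NegLimitedLoglogSlices.lean` / `NegLimitedLogOverLoglogSlices.lean` is a language
in `P` (Tardos's function), which can never serve the route's thesis at Markov's border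
(`P ⊆ P/poly` and Fischer). Here the SAME rungs are proved for an `NP`-complete witness:
* `sqrtCliqueLang` — bit matrices `u` (`|u| = m²`) whose upper-triangle graph has a clique on
  `⌊√m⌋` vertices — is in `NP` by an explicit certificate verifier
  (`Literature.Computability.Complexity.CliqueVerifier.verFn ∈ FP`; `sqrtCliqueLang_mem_NP`), and
  its slice at length `m²` is `CLIQUE(m, ⌊√m⌋)` of the edge vector (`sliceFn_sqrtCliqueLang`);
* `neglimitedLogOverLoglogNegations_clique` (**R35-CLIQUE**): for every `k`, infinitely often the
  slice is monotone and needs `> n^k` De Morgan gates under `⌊log₂ n⌋ / (40 (⌊log₂⌊log₂ n⌋⌋ + 1))`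
  NOT gates — from T1 (`NegLimLog.cliqueLikeNegLimitedLog`) through the input retraction of
  `NegLimitedLoglogSlices.lean`; `neglimitedAllCLoglogNegations_clique` is the `c·log₂log₂ n` form.
Cell record: HOME/pnp-ideate-p3/ROUND-3.md §4(d).
-/

set_option linter.dupNamespace false -- `Summit.PneNP.PneNP.…`: summit = sub-problem name (D-0017 single-conjunct layout)

namespace Summit.PneNP.PneNP.Theorems.NegLimSlices

open Literature.Computability.Complexity Literature.Computability.Complexity.Brick
  Literature.Barriers.PneNP _root_.Computability Polynomial Filter Finset

variable {m : ℕ}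

/-! ## The language and its membership in `NP` -/

/-- The verifier language `{z | verFn z = 1}`. [folklore] -/
def cliqueVerLang : Language Bool := {z | CliqueVerifier.verFn z = [true]}

/-- Membership in the verifier language. [folklore] -/
theorem mem_cliqueVerLang {z : List Bool} :
    z ∈ cliqueVerLang ↔ CliqueVerifier.verFn z = [true] := Iff.rfl

/-- The verifier language is in `P`. [cite: AroraBarakCC2009, Thm. 2.8] -/
theorem cliqueVerLang_mem_P : cliqueVerLang ∈ Classes.P :=
  setOf_apply_eq_apply_mem_P CliqueVerifier.verFn_mem_FP (const_mem_FP [true])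

/-- **The `⌊√m⌋`-clique language**: strings `u` with a certificate `y`, `|y| ≤ |u|`, accepted by
the clique verifier (for `|u| = m²`: the upper-triangle graph of `u` has a clique on `⌊√m⌋`
vertices, `sliceFn_sqrtCliqueLang`). [cite: AroraBarak2009, §2.1 Ex. 2.2] -/
def sqrtCliqueLang : Language Bool :=
  {u | ∃ y : List Bool, y.length ≤ (X : Polynomial ℕ).eval u.length ∧ boolPair u y ∈ cliqueVerLang}

/-- **`sqrtCliqueLang ∈ NP`** (certificate definition). [cite: AroraBarak2009, Def. 2.1] -/
theorem sqrtCliqueLang_mem_NP : sqrtCliqueLang ∈ Nondeterministic.NP :=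
  mem_NP_iff_verifier.2 ⟨cliqueVerLang, cliqueVerLang_mem_P, X, fun _ => Iff.rfl⟩

/-! ## The slice at a square length is `CLIQUE(m, ⌊√m⌋)` -/

/-- Counting the ones of a Boolean list through its positions below `n ≥ |l|`. [folklore] -/
theorem card_filter_range_getD (l : List Bool) {n : ℕ} (hn : l.length ≤ n) :
    ((Finset.range n).filter fun i => l.getD i false = true).card = l.count true := by
  induction l using List.reverseRecOn generalizing n with
  | nil => simp
  | append_singleton l b ih =>
    rw [List.length_append, List.length_singleton] at hn
    have hsplit : ((Finset.range n).filter fun i => (l ++ [b]).getD i false = true) =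
        ((Finset.range n).filter fun i => l.getD i false = true) ∪
          (if b = true then {l.length} else ∅) := by
      ext i
      simp only [Finset.mem_union, Finset.mem_filter, Finset.mem_range]
      rcases lt_trichotomy i l.length with hi | rfl | hi
      · rw [List.getD_append _ _ _ _ hi]
        constructor
        · exact fun h => Or.inl h
        · rintro (h | h)
          · exact h
          · cases b <;> simp at h; omega
      · rw [List.getD_append_right _ _ _ _ le_rfl, Nat.sub_self, List.getD_cons_zero,
          List.getD_eq_default _ _ le_rfl]
        cases b <;> simp; omega
      · rw [List.getD_eq_default _ _ (by simp; omega), List.getD_eq_default _ _ hi.le]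
        cases b <;> simp; omega
    have hdisj : Disjoint ((Finset.range n).filter fun i => l.getD i false = true)
        (if b = true then {l.length} else ∅) := by
      cases b
      · simp
      · simp only [if_true, Finset.disjoint_singleton_right, Finset.mem_filter, not_and]
        intro _
        rw [List.getD_eq_default _ _ le_rfl]; simp
    rw [hsplit, Finset.card_union_of_disjoint hdisj, ih (by omega), List.count_append,
      List.count_singleton']
    cases b <;> simp

/-- From positions to vertices: `#{a : Fin n | P a} = #{i < n | P i}`. [folklore] -/
theorem card_filter_univ_fin (n : ℕ) (P : ℕ → Prop) [DecidablePred P] :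
    ((Finset.univ : Finset (Fin n)).filter fun a : Fin n => P (a : ℕ)).card =
      ((Finset.range n).filter P).card := by
  rw [← Finset.card_map Fin.valEmbedding]
  congr 1
  ext i
  simp only [Finset.mem_map, Finset.mem_filter, Finset.mem_univ, true_and, Fin.valEmbedding_apply,
    Finset.mem_range]
  constructor
  · rintro ⟨a, ha, rfl⟩; exact ⟨a.2, ha⟩
  · rintro ⟨hi, hP⟩; exact ⟨⟨i, hi⟩, hP, rfl⟩

/-- The matrix position of the edge `{a, b}` is `max + m · min`. [folklore] -/
theorem edgePos_mk_val (a b : Fin m) (h : s(a, b) ∈ (⊤ : SimpleGraph (Fin m)).edgeSet) :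
    ((edgePos ⟨s(a, b), h⟩ : Fin (m * m)) : ℕ) = (max a b : ℕ) + m * (min a b : ℕ) := by
  simp only [edgePos, Sym2.lift_mk, finProdFinEquiv_apply_val, Fin.coe_max, Fin.coe_min]

/-- **`CLIQUE(m, s)` of the upper-triangle graph in matrix coordinates**: some `s`-set `S` of
vertices has `w_{b + m·a} = 1` for all `a < b` in `S`. [folklore] -/
theorem cliqueFn_edgeVec_iff (s : ℕ) (w : Fin (m * m) → Bool) :
    cliqueFn m s (edgeVec w) = true ↔ ∃ S : Finset (Fin m), S.card = s ∧
      ∀ a ∈ S, ∀ b ∈ S, a < b → ∀ h : (b : ℕ) + m * (a : ℕ) < m * m,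
        w ⟨(b : ℕ) + m * (a : ℕ), h⟩ = true := by
  have hlt2 : ∀ a b : Fin m, (max a b : ℕ) + m * (min a b : ℕ) < m * m := fun a b => by
    have h1 : ((max a b : Fin m) : ℕ) < m := (max a b).2
    have h2 : ((min a b : Fin m) : ℕ) < m := (min a b).2
    nlinarith
  -- adjacency of the upper-triangle graph in matrix coordinates
  have hG : ∀ a b : Fin m, (SimpleGraph.fromEdgeSet {e : Sym2 (Fin m) |
      ∃ h : e ∈ (⊤ : SimpleGraph (Fin m)).edgeSet, edgeVec w ⟨e, h⟩ = true}).Adj a b ↔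
        a ≠ b ∧ w ⟨(max a b : ℕ) + m * (min a b : ℕ), hlt2 a b⟩ = true := by
    intro a b
    rw [SimpleGraph.fromEdgeSet_adj, Set.mem_setOf_eq]
    constructor
    · rintro ⟨⟨h, hw⟩, hab⟩
      refine ⟨hab, ?_⟩
      rw [edgeVec] at hw
      rwa [show (⟨(max a b : ℕ) + m * (min a b : ℕ), _⟩ : Fin (m * m)) = edgePos ⟨s(a, b), h⟩ from
        Fin.ext (edgePos_mk_val a b h).symm]
    · rintro ⟨hab, hw⟩
      have h : s(a, b) ∈ (⊤ : SimpleGraph (Fin m)).edgeSet := by simpa using hab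
      refine ⟨⟨h, ?_⟩, hab⟩
      rw [edgeVec, show edgePos ⟨s(a, b), h⟩ = ⟨(max a b : ℕ) + m * (min a b : ℕ), _⟩ from
        Fin.ext (edgePos_mk_val a b h)]
      exact hw
  rw [cliqueFn]
  simp only [decide_eq_true_eq, SimpleGraph.CliqueFree, not_forall, not_not]
  refine exists_congr fun S => ?_
  rw [SimpleGraph.isNClique_iff, SimpleGraph.isClique_iff, and_comm]
  refine and_congr Iff.rfl ⟨fun hcl a ha b hb hab h => ?_, fun hcl a ha b hb hab => ?_⟩
  · have hab' : (a : ℕ) < b := hab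
    have hw := ((hG a b).1 (hcl ha hb (ne_of_lt hab))).2
    rw [← hw]
    congr 1
    apply Fin.ext
    show (b : ℕ) + m * (a : ℕ) = max (a : ℕ) b + m * min (a : ℕ) b
    rw [max_eq_right hab'.le, min_eq_left hab'.le]
  · rw [hG]
    refine ⟨hab, ?_⟩
    rcases lt_or_gt_of_ne (Fin.val_injective.ne hab) with hlt | hlt
    · have hw := hcl a ha b hb hlt (by have := a.2; have := b.2; nlinarith)
      rw [← hw]
      congr 1
      apply Fin.ext
      show max (a : ℕ) b + m * min (a : ℕ) b = (b : ℕ) + m * (a : ℕ)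
      rw [max_eq_right hlt.le, min_eq_left hlt.le]
    · have hw := hcl b hb a ha hlt (by have := a.2; have := b.2; nlinarith)
      rw [← hw]
      congr 1
      apply Fin.ext
      show max (a : ℕ) b + m * min (a : ℕ) b = (a : ℕ) + m * (b : ℕ)
      rw [max_eq_left hlt.le, min_eq_right hlt.le]

/-- **Slices of the `⌊√m⌋`-clique language at square lengths, in matrix coordinates** (`1 ≤ m`):
`L_{m²}(w) = 1` iff some `⌊√m⌋`-set `S` has `w_{b + m·a} = 1` for all `a < b` in `S` (stated over
Mathlib alone, so that it can be a route item). [cite: AroraBarak2009, §2.1 Ex. 2.2] -/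
theorem sliceFn_sqrtCliqueLang_eq_true_iff (hm : 1 ≤ m) (w : Fin (m * m) → Bool) :
    sqrtCliqueLang.sliceFn (m * m) w = true ↔ ∃ S : Finset (Fin m), S.card = Nat.sqrt m ∧
      ∀ a ∈ S, ∀ b ∈ S, a < b → ∀ h : (b : ℕ) + m * (a : ℕ) < m * m,
        w ⟨(b : ℕ) + m * (a : ℕ), h⟩ = true := by
  have hm0 : 0 < m := hm
  have hu : (List.ofFn w).length = m * m := by simp
  -- the pair `a < b` sits at position `t = b + m a`, with `t / m = a`, `t % m = b`
  have hdiv : ∀ a b : ℕ, b < m → (b + m * a) / m = a := fun a b hb => by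
    rw [Nat.add_mul_div_left _ _ hm0, Nat.div_eq_of_lt hb, zero_add]
  have hmod : ∀ a b : ℕ, b < m → (b + m * a) % m = b := fun a b hb => by
    rw [Nat.add_mul_mod_self_left, Nat.mod_eq_of_lt hb]
  show sqrtCliqueLang.boolIndicator (List.ofFn w) = true ↔ _
  rw [← Set.mem_iff_boolIndicator, sqrtCliqueLang, Set.mem_setOf_eq]
  simp only [mem_cliqueVerLang, CliqueVerifier.verFn_sq hu, List.cons.injEq, and_true, eval_X, hu,
    CliqueVerifier.accepts_eq_true_iff]
  constructor
  · -- a certificate gives a clique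
    rintro ⟨y, -, hcnt, hedge⟩
    refine ⟨Finset.univ.filter fun a : Fin m => (y.take m).getD a false = true, ?_, ?_⟩
    · rw [card_filter_univ_fin m fun i => (y.take m).getD i false = true,
        card_filter_range_getD _ (by simp), hcnt]
    · intro a ha b hb hab h
      simp only [Finset.mem_filter, Finset.mem_univ, true_and] at ha hb
      have hab' : (a : ℕ) < b := hab
      have h1 := hedge _ h
      rw [hdiv _ _ b.2, hmod _ _ b.2] at h1
      rw [← Kannan.getD_ofFn w h]
      exact h1 hab' ha hb
  · -- a clique gives a certificate
    rintro ⟨S, hcard, hcl⟩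
    set y : List Bool := List.ofFn fun a : Fin m => decide (a ∈ S) with hy
    have hylen : y.length = m := by simp [hy]
    have hty : y.take m = y := List.take_of_length_le hylen.le
    have hyget : ∀ a : Fin m, y.getD a false = decide (a ∈ S) := fun a => by
      rw [hy, Kannan.getD_ofFn _ a.2]
    refine ⟨y, by rw [hylen]; exact Nat.le_mul_self m, ?_, ?_⟩
    · rw [hty, ← card_filter_range_getD y hylen.le,
        ← card_filter_univ_fin m fun i => y.getD i false = true, ← hcard]
      congr 1
      ext a
      simp only [Finset.mem_filter, Finset.mem_univ, true_and, hyget a, decide_eq_true_iff]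
    · intro t ht hab hya hyb
      rw [hty] at hya hyb
      have hbm : t % m < m := Nat.mod_lt _ hm0
      have ham : t / m < m := Nat.div_lt_of_lt_mul ht
      have ha : (⟨t / m, ham⟩ : Fin m) ∈ S := by
        have h := hyget ⟨t / m, ham⟩
        rwa [h, decide_eq_true_iff] at hya
      have hb : (⟨t % m, hbm⟩ : Fin m) ∈ S := by
        have h := hyget ⟨t % m, hbm⟩
        rwa [h, decide_eq_true_iff] at hyb
      have hw := hcl _ ha _ hb hab (by rw [Nat.mod_add_div]; exact ht)
      rw [Kannan.getD_ofFn w ht, ← hw]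
      congr 1
      apply Fin.ext
      exact (Nat.mod_add_div t m).symm

/-- **The slice of the `⌊√m⌋`-clique language at length `m²` is `CLIQUE(m, ⌊√m⌋)` of the edge
vector** (`1 ≤ m`). [cite: AroraBarak2009, §2.1 Ex. 2.2] -/
theorem sliceFn_sqrtCliqueLang (hm : 1 ≤ m) (w : Fin (m * m) → Bool) :
    sqrtCliqueLang.sliceFn (m * m) w = cliqueFn m (Nat.sqrt m) (edgeVec w) := by
  rw [Bool.eq_iff_iff, sliceFn_sqrtCliqueLang_eq_true_iff hm, cliqueFn_edgeVec_iff]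

/-! ## Transfer package and the two statements for the clique witness -/

/-- **The transfer package at a square length for the clique witness.** For `m ≥ 4` and any NOT
budget `b`: a lower bound `s` for every De Morgan circuit with `≤ b` NOT gates computing
`CLIQUE(m, ⌊√m⌋)` gives `s ≤ negLimitedSizeOver deMorganBasis b (L_{m²})`. [folklore] -/
theorem le_negLimitedSizeOver_sliceFn_clique (hm : 4 ≤ m) {b s : ℕ}
    (hlow : ∀ D : Circuit (KEdge m), D.IsOver deMorganBasis →
      D.Computes (cliqueFn m (Nat.sqrt m)) → D.negationCount ≤ b → s ≤ D.size) :
    s ≤ negLimitedSizeOver deMorganBasis b (sqrtCliqueLang.sliceFn (m * m)) := by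
  have hk : 2 ≤ Nat.sqrt m := Nat.le_sqrt'.2 (by omega)
  have hTcl : CliqueLike (univ : Finset (Fin m)) (Nat.sqrt m - 1) (Nat.sqrt m)
      (cliqueFn m (Nat.sqrt m)) := cliqueLike_cliqueFn (m := m) (Nat.le_sqrt.2 (by omega))
  have e₀ : KEdge m := ⟨s(⟨0, by omega⟩, ⟨1, by omega⟩), by simp [Fin.ext_iff]⟩
  refine le_negLimitedSizeOver_of_retract (g := cliqueFn m (Nat.sqrt m)) (edgeOfPos e₀)
    (fun y => ?_) ?_ hlow
  · rw [sliceFn_sqrtCliqueLang (by omega), edgeVec_comp_edgeOfPos]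
  · obtain ⟨C₀, hB₀, hC₀⟩ :=
      exists_monotone_circuit_of_cliqueLike hTcl (by omega) (Nat.sqrt_le_self m)
    refine ⟨C₀.mapInputs edgePos, (hB₀.mapInputs _).mono monotoneBasis_subset_deMorgan, ?_,
      fun x => ?_⟩
    · rw [negationCount_mapInputs, Circuit.negationCount_eq_zero_of_isOver_monotoneBasis hB₀]
      exact Nat.zero_le _
    · rw [Circuit.eval_mapInputs, hC₀, sliceFn_sqrtCliqueLang (by omega)]
      rfl

/-- The slices of the clique language at square lengths are monotone (`1 ≤ m`). [folklore] -/
theorem monotone_sliceFn_sqrtCliqueLang (hm : 1 ≤ m) : Monotone (sqrtCliqueLang.sliceFn (m * m)) := by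
  intro x y hxy
  rw [sliceFn_sqrtCliqueLang hm, sliceFn_sqrtCliqueLang hm]
  exact (cliqueLike_cliqueFn (m := m) (Nat.le_sqrt.2 (by omega))).mono fun e => hxy (edgePos e)

/-- **R35-CLIQUE**: the `⌊√m⌋`-clique language `L ∈ NP` has, infinitely often, monotone slices of
negation-limited complexity `> n^k` under `⌊log₂ n⌋ / (40 (⌊log₂⌊log₂ n⌋⌋ + 1))` NOT gates, for
every `k` (T1 at `F = CLIQUE(m, ⌊√m⌋)` through the slice plumbing). Print record for
`CLIQUE`: `(1/6) log log n` (Amano–Maruoka 2005). -/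
theorem neglimitedLogOverLoglogNegations_clique :
    sqrtCliqueLang ∈ Literature.Computability.Complexity.Nondeterministic.NP ∧ ∀ k : ℕ,
      ∃ᶠ n : ℕ in Filter.atTop, Monotone (sqrtCliqueLang.sliceFn n) ∧ n ^ k <
        Literature.Computability.Complexity.negLimitedSizeOver
          Literature.Computability.Complexity.deMorganBasis
          (Nat.log 2 n / (40 * (Nat.log 2 (Nat.log 2 n) + 1))) (sqrtCliqueLang.sliceFn n) := by
  refine ⟨sqrtCliqueLang_mem_NP, fun k => frequently_of_eventually_sq ?_⟩
  filter_upwards [NegLimLog.cliqueLikeNegLimitedLog (2 * k + 1), eventually_ge_atTop 4] with m hm h4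
  have hle : m ^ (2 * k + 1) ≤ negLimitedSizeOver deMorganBasis
      (Nat.log 2 (m * m) / (40 * (Nat.log 2 (Nat.log 2 (m * m)) + 1)))
      (sqrtCliqueLang.sliceFn (m * m)) :=
    le_negLimitedSizeOver_sliceFn_clique h4 fun D hD hDT hneg =>
      hm _ (cliqueLike_cliqueFn (m := m) (Nat.le_sqrt.2 (by omega))) D hD hDT
        (hneg.trans (budgetR35_le_logBudget m))
  refine ⟨monotone_sliceFn_sqrtCliqueLang (by omega), ?_⟩
  calc (m * m) ^ k = m ^ (2 * k) := by rw [← pow_two, ← pow_mul]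
    _ < m ^ (2 * k + 1) := Nat.pow_lt_pow_right (by omega) (by omega)
    _ ≤ _ := hle

/-- **The `c·log₂log₂ n` form for the clique witness** (crux #3's shape with `Monotone`, one `L`
for all `c`). -/
theorem neglimitedAllCLoglogNegations_clique :
    sqrtCliqueLang ∈ Literature.Computability.Complexity.Nondeterministic.NP ∧ ∀ c k : ℕ,
      ∃ᶠ n : ℕ in Filter.atTop, Monotone (sqrtCliqueLang.sliceFn n) ∧ n ^ k <
        Literature.Computability.Complexity.negLimitedSizeOver
          Literature.Computability.Complexity.deMorganBasis (c * Nat.log 2 (Nat.log 2 n))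
          (sqrtCliqueLang.sliceFn n) := by
  refine ⟨sqrtCliqueLang_mem_NP, fun c k => frequently_of_eventually_sq ?_⟩
  filter_upwards [cliqueLike_sqrt_negationLimited_sqrtLog (2 * k + 1), eventually_ge_atTop 4,
    tendsto_loglog.eventually_ge_atTop (max 64 (c + 2))] with m hm h4 hK
  have hb := budget_le_sqrtLogBudget (le_trans (le_max_left _ _) hK) (le_trans (le_max_right _ _) hK)
  have hle : m ^ (2 * k + 1) ≤ negLimitedSizeOver deMorganBasis (c * Nat.log 2 (Nat.log 2 (m * m)))
      (sqrtCliqueLang.sliceFn (m * m)) :=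
    le_negLimitedSizeOver_sliceFn_clique h4 fun D hD hDT hneg =>
      hm _ (cliqueLike_cliqueFn (m := m) (Nat.le_sqrt.2 (by omega))) D hD hDT (hneg.trans hb)
  refine ⟨monotone_sliceFn_sqrtCliqueLang (by omega), ?_⟩
  calc (m * m) ^ k = m ^ (2 * k) := by rw [← pow_two, ← pow_mul]
    _ < m ^ (2 * k + 1) := Nat.pow_lt_pow_right (by omega) (by omega)
    _ ≤ _ := hle

/-- **R35-CLIQUE as a route statement** (typed over Mathlib and the complexity library only, so
that it elaborates in the route file): an `NP` language whose slices at square lengths are the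
`⌊√m⌋`-clique problem of the upper triangle, with the `log / log log` negation-limited bound. -/
theorem neglimitedLogOverLoglogClique :
    ∃ L ∈ Literature.Computability.Complexity.Nondeterministic.NP,
      (∀ m : ℕ, 1 ≤ m → ∀ w : Fin (m * m) → Bool, L.sliceFn (m * m) w = true ↔
        ∃ S : Finset (Fin m), S.card = Nat.sqrt m ∧ ∀ a ∈ S, ∀ b ∈ S, a < b →
          ∀ h : (b : ℕ) + m * (a : ℕ) < m * m, w ⟨(b : ℕ) + m * (a : ℕ), h⟩ = true) ∧
      ∀ k : ℕ, ∃ᶠ n : ℕ in Filter.atTop, Monotone (L.sliceFn n) ∧ n ^ k <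
        Literature.Computability.Complexity.negLimitedSizeOver
          Literature.Computability.Complexity.deMorganBasis
          (Nat.log 2 n / (40 * (Nat.log 2 (Nat.log 2 n) + 1))) (L.sliceFn n) :=
  ⟨sqrtCliqueLang, sqrtCliqueLang_mem_NP, fun _ hm w => sliceFn_sqrtCliqueLang_eq_true_iff hm w,
    neglimitedLogOverLoglogNegations_clique.2⟩

end Summit.PneNP.PneNP.Theorems.NegLimSlices

namespace Summit.PneNP.PneNP.Theorems

/-- **stmt-PneNP-19760 (`NegLimited.NeglimitedLogOverLoglogClique`, R35-CLIQUE) PROVED, by name.**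
[cite: AmanoMaruoka2005, §1] [cite: AroraBarak2009, §2.1] -/
theorem neglimitedLogOverLoglogClique_holds :
    Summit.PneNP.PneNP.Theses.NegLimited.NeglimitedLogOverLoglogClique :=
  NegLimSlices.neglimitedLogOverLoglogClique

end Summit.PneNP.PneNP.Theorems
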